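import Summits.QuantumFields.YangMills.Theorems.AtomicCalibrationROffDiagonalFlatness

/-!
# AtomicCalibrationR (stmt-QuantumFields-28169), E2 `stub_offDiagonalWhitney` — LOCAL flatness off the coincidence locus
# (Plan A step 2 / step 6 of planner ym-idea-11 g15's `STUB-PLAN-offDiagonalWhitney.md`; prover w4 g22, free hands)

The landed flatness estimates (`AtomicCalibrationROffDiagonalFlatness`, `…DistFat`) bound `‖D^m F(z)‖` by the GLOBAL sup
`seminorm(0,K)(F)`; the Schwartz bookkeeping of `WhitneyPkg` (vi) needs the same estimate with the sup of `‖D^K F‖` over a BALL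
around `z` only, so that the spatial decay of `F` survives into the mass sum.  The Taylor remainder along the segment only sees the
segment, so the proofs localise verbatim:

* `norm_sub_taylor_line_le_local` — Taylor along `t ↦ x + t•v` with `‖D^{n+1} g‖ ≤ B` assumed on the segment only
  (adapted from `AtomicSynthesisMolliTaylorLine.norm_sub_taylor_line_le`);
* `norm_le_of_jets_eq_zero_local`, `norm_iteratedFDeriv_le_of_jets_eq_zero_local`;
* `IsOffDiagonal.norm_iteratedFDeriv_le_of_pair_local` — for `F ∈ ⁰𝒮`, `l ≠ l'`, `m < K` and any `B` with `‖D^K F w‖ ≤ B` on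
  `closedBall z (‖z_l − z_{l'}‖/2)`: `‖D^m F(z)‖ ≤ B (‖z_l − z_{l'}‖/2)^{K−m}/(K−m−1)!`.

No stub/crux/rung/summit is closed; nothing here touches Yang–Mills; the YM mass gap is NOT proved. [folklore]
-/

set_option autoImplicit false

noncomputable section

open scoped BigOperators ContDiff Nat Topology
open Set Metric
open Summit.QuantumFields.YangMills.Theorems.AtomicSynthesisMolli (contDiff_comp_line iteratedDeriv_comp_line
  norm_iteratedFDeriv_apply_diag_le)
open Summit.QuantumFields.YangMills.Cruxes.AtomicCalibrationR.OffDiagonalFlatness (norm_iteratedFDeriv_iteratedFDeriv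
  iteratedFDeriv_iteratedFDeriv_eq_zero average_mem_coincidenceLocus norm_sub_average_le)
open Literature.MathematicalPhysics.AQFT (coincidenceLocus IsOffDiagonal)

namespace Summit.QuantumFields.YangMills.Cruxes.AtomicCalibrationR.LocalFlatness

variable {E : Type} [NormedAddCommGroup E] [NormedSpace ℝ E]

/-- **Taylor along a line, local remainder bound.**  As `norm_sub_taylor_line_le`, but `‖D^{n+1} g‖ ≤ B` is only assumed at the
points `x + y•v`, `y ∈ [0, τ]`. (adapted from Theorems/AtomicSynthesisMolliTaylorLine) [folklore] -/
theorem norm_sub_taylor_line_le_local {F : Type} [NormedAddCommGroup F] [NormedSpace ℝ F] {g : E → F}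
    (hg : ContDiff ℝ ∞ g) (x v : E) {τ : ℝ} (hτ : 0 < τ) (n : ℕ) {B : ℝ}
    (hB : ∀ y ∈ Icc (0 : ℝ) τ, ‖iteratedFDeriv ℝ (n + 1) g (x + y • v)‖ ≤ B) :
    ‖g (x + τ • v) - ∑ j ∈ Finset.range (n + 1), ((j ! : ℝ)⁻¹ * τ ^ j) • iteratedFDeriv ℝ j g x (fun _ => v)‖ ≤
      B * ‖v‖ ^ (n + 1) * τ ^ (n + 1) / n ! := by
  set ψ : ℝ → F := fun s => g (x + s • v) with hψ
  have hψd : ContDiff ℝ ∞ ψ := contDiff_comp_line hg x v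
  have hU : UniqueDiffOn ℝ (Icc (0 : ℝ) τ) := uniqueDiffOn_Icc hτ
  have hder : ∀ (j : ℕ) (y : ℝ), y ∈ Icc (0 : ℝ) τ →
      iteratedDerivWithin j ψ (Icc 0 τ) y = iteratedFDeriv ℝ j g (x + y • v) (fun _ => v) := by
    intro j y hy
    rw [iteratedDerivWithin_eq_iteratedDeriv hU ((hψd.of_le (by exact_mod_cast le_top)).contDiffAt) hy]
    exact iteratedDeriv_comp_line hg x v j y
  have hC : ∀ y ∈ Icc (0 : ℝ) τ, ‖iteratedDerivWithin (n + 1) ψ (Icc 0 τ) y‖ ≤ B * ‖v‖ ^ (n + 1) := by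
    intro y hy
    rw [hder (n + 1) y hy]
    exact (norm_iteratedFDeriv_apply_diag_le g _ v (n + 1)).trans
      (mul_le_mul_of_nonneg_right (hB y hy) (pow_nonneg (norm_nonneg _) _))
  have key := taylor_mean_remainder_bound (f := ψ) (a := 0) (b := τ) (x := τ) (n := n) hτ.le
    ((hψd.of_le (by exact_mod_cast le_top)).contDiffOn) (right_mem_Icc.2 hτ.le) hC
  have hT : taylorWithinEval ψ n (Icc 0 τ) 0 τ =
      ∑ j ∈ Finset.range (n + 1), ((j ! : ℝ)⁻¹ * τ ^ j) • iteratedFDeriv ℝ j g x (fun _ => v) := by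
    rw [taylor_within_apply]
    refine Finset.sum_congr rfl fun j _ => ?_
    rw [hder j 0 (left_mem_Icc.2 hτ.le), zero_smul, add_zero, sub_zero]
  have hψτ : ψ τ = g (x + τ • v) := rfl
  rw [hT, hψτ, sub_zero] at key
  exact key

/-- **Flat functions are small near a flat point, local form**: jets of orders `≤ n` vanish at `w₀` and `‖D^{n+1} g‖ ≤ B` on the
segment `[w₀, z]` ⇒ `‖g z‖ ≤ B ‖z − w₀‖^{n+1}/n!`. -/
theorem norm_le_of_jets_eq_zero_local {F : Type} [NormedAddCommGroup F] [NormedSpace ℝ F] (g : E → F)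
    (hg : ContDiff ℝ ∞ g) (w₀ z : E) (n : ℕ) (hjet : ∀ j : ℕ, j ≤ n → iteratedFDeriv ℝ j g w₀ = 0) {B : ℝ}
    (hB : ∀ t ∈ Icc (0 : ℝ) 1, ‖iteratedFDeriv ℝ (n + 1) g (w₀ + t • (z - w₀))‖ ≤ B) :
    ‖g z‖ ≤ B * ‖z - w₀‖ ^ (n + 1) / n ! := by
  have h := norm_sub_taylor_line_le_local hg w₀ (z - w₀) one_pos n hB
  have hsum : ∑ j ∈ Finset.range (n + 1), ((j ! : ℝ)⁻¹ * (1 : ℝ) ^ j) • iteratedFDeriv ℝ j g w₀ (fun _ => z - w₀) = 0 := by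
    refine Finset.sum_eq_zero fun j hj => ?_
    rw [hjet j (Nat.lt_succ_iff.mp (Finset.mem_range.mp hj)), zero_apply, smul_zero]
  rw [hsum, sub_zero, one_smul, add_sub_cancel, one_pow, mul_one] at h
  exact h

/-- **Local flatness of the derivatives from vanishing jets**: all jets vanish at `w₀`, `‖D^K g‖ ≤ B` on the segment
`[w₀, z]`, `m < K` ⇒ `‖D^m g(z)‖ ≤ B ‖z − w₀‖^{K−m}/(K−m−1)!`. -/
theorem norm_iteratedFDeriv_le_of_jets_eq_zero_local {F : Type} [NormedAddCommGroup F] [NormedSpace ℝ F] (g : E → F)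
    (hg : ContDiff ℝ ∞ g) (w₀ z : E) (hjet : ∀ k : ℕ, iteratedFDeriv ℝ k g w₀ = 0) {K m : ℕ} (hm : m < K) {B : ℝ}
    (hB : ∀ t ∈ Icc (0 : ℝ) 1, ‖iteratedFDeriv ℝ K g (w₀ + t • (z - w₀))‖ ≤ B) :
    ‖iteratedFDeriv ℝ m g z‖ ≤ B * ‖z - w₀‖ ^ (K - m) / (K - m - 1) ! := by
  obtain ⟨n, hn⟩ : ∃ n : ℕ, K = n + 1 + m := ⟨K - m - 1, by omega⟩
  have hKm : K - m = n + 1 := by omega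
  have hKm1 : K - m - 1 = n := by omega
  rw [hKm1, hKm]
  refine norm_le_of_jets_eq_zero_local (iteratedFDeriv ℝ m g) (hg.iteratedFDeriv_right (by exact_mod_cast le_top)) w₀ z n
    (fun j _ => iteratedFDeriv_iteratedFDeriv_eq_zero g hjet j m) fun t ht => ?_
  rw [norm_iteratedFDeriv_iteratedFDeriv, ← hn]
  exact hB t ht

variable {n : ℕ}

/-- Points of the segment from the two-slot average `w₀` to `z` stay in `closedBall z (‖z_l − z_{l'}‖/2)`. -/
theorem segment_mem_closedBall (z : Fin n → E) {l l' : Fin n} (hll' : l ≠ l') {t : ℝ} (ht : t ∈ Icc (0 : ℝ) 1) :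
    Function.update (Function.update z l ((2 : ℝ)⁻¹ • (z l + z l'))) l' ((2 : ℝ)⁻¹ • (z l + z l')) +
        t • (z - Function.update (Function.update z l ((2 : ℝ)⁻¹ • (z l + z l'))) l' ((2 : ℝ)⁻¹ • (z l + z l'))) ∈
      closedBall z (‖z l - z l'‖ / 2) := by
  set w₀ := Function.update (Function.update z l ((2 : ℝ)⁻¹ • (z l + z l'))) l' ((2 : ℝ)⁻¹ • (z l + z l')) with hw₀
  rw [mem_closedBall, dist_eq_norm]
  have h1 : w₀ + t • (z - w₀) - z = (1 - t) • (w₀ - z) := by module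
  rw [h1, norm_smul, Real.norm_eq_abs, abs_of_nonneg (by linarith [ht.2]), norm_sub_rev]
  have hd := norm_sub_average_le z hll'
  rw [← hw₀] at hd
  calc (1 - t) * ‖z - w₀‖ ≤ 1 * ‖z - w₀‖ := mul_le_mul_of_nonneg_right (by linarith [ht.1]) (norm_nonneg _)
    _ ≤ ‖z l - z l'‖ / 2 := by rw [one_mul]; exact hd

/-- **Local flatness of `⁰𝒮` functions off the fat diagonal, pair form.**  For `F ∈ ⁰𝒮((E)ⁿ)`, slots `l ≠ l'`, `m < K` and a
bound `‖D^K F w‖ ≤ B` valid on `closedBall z (‖z_l − z_{l'}‖/2)` only: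
`‖D^m F(z)‖ ≤ B (‖z_l − z_{l'}‖/2)^{K−m}/(K−m−1)!`. [folklore] -/
theorem _root_.Literature.MathematicalPhysics.AQFT.IsOffDiagonal.norm_iteratedFDeriv_le_of_pair_local
    {F : SchwartzMap (Fin n → E) ℂ} (hF : IsOffDiagonal F) {l l' : Fin n} (hll' : l ≠ l') {K m : ℕ} (hm : m < K)
    (z : Fin n → E) {B : ℝ} (hB : ∀ w ∈ closedBall z (‖z l - z l'‖ / 2), ‖iteratedFDeriv ℝ K F w‖ ≤ B) :
    ‖iteratedFDeriv ℝ m F z‖ ≤ B * (‖z l - z l'‖ / 2) ^ (K - m) / (K - m - 1) ! := by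
  set w₀ := Function.update (Function.update z l ((2 : ℝ)⁻¹ • (z l + z l'))) l' ((2 : ℝ)⁻¹ • (z l + z l')) with hw₀
  have hB0 : 0 ≤ B := (norm_nonneg _).trans (hB z (mem_closedBall_self (by positivity)))
  have h := norm_iteratedFDeriv_le_of_jets_eq_zero_local (F : (Fin n → E) → ℂ) (F.smooth _) w₀ z
    (hF w₀ (average_mem_coincidenceLocus z hll')) hm (B := B) fun t ht => hB _ (segment_mem_closedBall z hll' ht)
  refine h.trans ?_
  have hd := norm_sub_average_le z hll'
  rw [← hw₀] at hd
  have hfac : (0 : ℝ) < (K - m - 1) ! := by positivity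
  rw [div_le_div_iff_of_pos_right hfac]
  exact mul_le_mul_of_nonneg_left (pow_le_pow_left₀ (norm_nonneg _) hd _) hB0

end Summit.QuantumFields.YangMills.Cruxes.AtomicCalibrationR.LocalFlatness

end
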